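import Summits.CriticalPhenomena.SAWScalingLimit.Theorems.BoundaryTP2Negative_Box3
import HarnessLib

/-!
# Negative knowledge on crux `BoundaryTP2`, part 5: the inequality is fugacity-dependent

The edge midpoints `A=(0,1), B=(1,0), C=(2,1), D=(1,2)` of the 3 × 3 box satisfy ALL hypotheses of
`BoundaryTP2` (`midpoints_interlaced` — a finite check over the certified complete enumerations —,
`midpoints_D1`, `midpoints_D2`).  Exactly `Z(A,C)=Z(B,D)=x²+6x⁴+2x⁶`, sides `2x²+2x⁴+4x⁶`, so crossing ≤
non-crossing iff `x ≤ √(1-√2/2) ≈ 0.5412`: it holds strictly at `x_c` (`midpointTP2_strict_at_xc`, under the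
quoted bounds `2.6 ≤ μ ≤ 2.7` which the tree discharges computationally) and FAILS
at `x = 3/5` (`midpointTP2_fails_at_three_fifths`, `not_midpointTP2_all_fugacities`).  Consequence for
provers: no fugacity-uniform argument (weight-preserving injection / switching bijection) can prove the crux;
any proof must use `x_c < 0.5412`. [folklore]
-/

namespace Summit.CriticalPhenomena.SAWScalingLimit.Theorems.BoundaryTP2.Negative

open Literature.Probability.LatticeModels Literature.Probability.RandomPlanarGeometry
open scoped ENNReal

section Midpoints

/-- `Z((1,0),(1,2)) = x²+6x⁴+2x⁶`. [folklore] -/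
theorem Z₃_10_12 {x : ℝ} (hx : 0 ≤ x) :
    Z₃ x ![1, 0] ![1, 2] = ENNReal.ofReal ([6, 4, 4, 6, 4, 4, 4, 4, 2].map fun k => x ^ k).sum :=
  Z₃_eq (by decide) _ (by decide) (by decide) hx

/-- `Z((0,1),(1,0)) = 2x²+2x⁴+4x⁶`. [folklore] -/
theorem Z₃_01_10 {x : ℝ} (hx : 0 ≤ x) :
    Z₃ x ![0, 1] ![1, 0] = ENNReal.ofReal ([4, 6, 2, 6, 6, 6, 4, 2].map fun k => x ^ k).sum :=
  Z₃_eq (by decide) _ (by decide) (by decide) hx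

/-- `Z((2,1),(1,2)) = 2x²+2x⁴+4x⁶`. [folklore] -/
theorem Z₃_21_12 {x : ℝ} (hx : 0 ≤ x) :
    Z₃ x ![2, 1] ![1, 2] = ENNReal.ofReal ([4, 2, 6, 2, 6, 6, 6, 4].map fun k => x ^ k).sum :=
  Z₃_eq (by decide) _ (by decide) (by decide) hx

/-- **Interlacing of the midpoint quadruple** (hypothesis (i) of `BoundaryTP2`): every SAW `A → C` meets
every SAW `B → D` — a finite check over the certified complete enumerations. [folklore] -/
theorem midpoints_interlaced (P : SAW.DomainSAW Ω₃ 1 ![0, 1] ![2, 1]) (Q : SAW.DomainSAW Ω₃ 1 ![1, 0] ![1, 2]) :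
    ∃ v, v ∈ P.walk.support ∧ v ∈ Q.walk.support := by
  have hP := support_mem_pathsFrom eqSite_iff mem_nb₃ 8 P.walk [] P.isPath (length_le_eight (by decide) P) (by simp)
  have hQ := support_mem_pathsFrom eqSite_iff mem_nb₃ 8 Q.walk [] Q.isPath (length_le_eight (by decide) Q) (by simp)
  have hPe := endsAt_support eqSite_iff P.walk
  have hQe := endsAt_support eqSite_iff Q.walk
  -- the finite certificate
  have key : (((pathsFrom eqSite nb₃ 8 ![0, 1] []).filter (endsAt eqSite ![2, 1])).all fun s =>
      ((pathsFrom eqSite nb₃ 8 ![1, 0] []).filter (endsAt eqSite ![1, 2])).all fun t =>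
        s.any fun v => t.any (eqSite v)) = true := by decide
  rw [List.all_eq_true] at key
  have k1 := key P.walk.support (List.mem_filter.2 ⟨hP, hPe⟩)
  rw [List.all_eq_true] at k1
  have k2 := k1 Q.walk.support (List.mem_filter.2 ⟨hQ, hQe⟩)
  rw [List.any_eq_true] at k2
  obtain ⟨v, hv, hv'⟩ := k2
  exact ⟨v, hv, (any_eqb_iff eqSite_iff).1 hv'⟩

/-- SAW `A → (0,0) → B`. [folklore] -/
def R₁ : SAW.DomainSAW Ω₃ 1 ![0, 1] ![1, 0] :=
  ⟨.cons (adj₃ (y := ![0, 0]) (by decide)) (.cons (adj₃ (by decide)) .nil), by simp [SimpleGraph.Walk.isPath_def]⟩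

/-- SAW `C → (2,2) → D`. [folklore] -/
def R₂ : SAW.DomainSAW Ω₃ 1 ![2, 1] ![1, 2] :=
  ⟨.cons (adj₃ (y := ![2, 2]) (by decide)) (.cons (adj₃ (by decide)) .nil), by simp [SimpleGraph.Walk.isPath_def]⟩

/-- SAW `A → (0,2) → D`. [folklore] -/
def R₃ : SAW.DomainSAW Ω₃ 1 ![0, 1] ![1, 2] :=
  ⟨.cons (adj₃ (y := ![0, 2]) (by decide)) (.cons (adj₃ (by decide)) .nil), by simp [SimpleGraph.Walk.isPath_def]⟩

/-- SAW `B → (2,0) → C`. [folklore] -/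
def R₄ : SAW.DomainSAW Ω₃ 1 ![1, 0] ![2, 1] :=
  ⟨.cons (adj₃ (y := ![2, 0]) (by decide)) (.cons (adj₃ (by decide)) .nil), by simp [SimpleGraph.Walk.isPath_def]⟩

/-- Hypothesis (ii) for the midpoint quadruple. [folklore] -/
theorem midpoints_D1 : ∃ (P : SAW.DomainSAW Ω₃ 1 ![0, 1] ![1, 0]) (Q : SAW.DomainSAW Ω₃ 1 ![2, 1] ![1, 2]),
    List.Disjoint P.walk.support Q.walk.support :=
  ⟨R₁, R₂, by simp [R₁, R₂]⟩

/-- Hypothesis (iii) for the midpoint quadruple. [folklore] -/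
theorem midpoints_D2 : ∃ (P : SAW.DomainSAW Ω₃ 1 ![0, 1] ![1, 2]) (Q : SAW.DomainSAW Ω₃ 1 ![1, 0] ![2, 1]),
    List.Disjoint P.walk.support Q.walk.support :=
  ⟨R₃, R₄, by simp [R₃, R₄]⟩

/-- **The midpoint inequality holds strictly at `x_c`** (margin `x_c²(1-4x_c²+2x_c⁴)`; uses only
`x_c ≤ 5/13`). [folklore] -/
theorem midpointTP2_strict_at_xc (hμ : SAW.LawlerSchrammWerner2004SAW_connectiveConstant_bounds) :
    Z₃ SAW.criticalFugacity ![0, 1] ![2, 1] * Z₃ SAW.criticalFugacity ![1, 0] ![1, 2] <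
      Z₃ SAW.criticalFugacity ![0, 1] ![1, 0] * Z₃ SAW.criticalFugacity ![2, 1] ![1, 2] := by
  have hx := SAW.criticalFugacity_pos_lt_one hμ
  have hx1 : SAW.criticalFugacity ≤ 5 / 13 := by
    rw [SAW.criticalFugacity]
    have h26 := hμ.1
    rw [inv_le_comm₀ (by linarith) (by norm_num)]
    norm_num
    linarith
  set x := SAW.criticalFugacity with hxdef
  rw [Z₃_01_21 hx.1.le, Z₃_10_12 hx.1.le, Z₃_01_10 hx.1.le, Z₃_21_12 hx.1.le, ← ENNReal.ofReal_mul, ← ENNReal.ofReal_mul,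
    ENNReal.ofReal_lt_ofReal_iff]
  · simp only [List.map_cons, List.map_nil, List.sum_cons, List.sum_nil, add_zero]
    have h2 : x ^ 2 ≤ 25 / 169 := by nlinarith [hx.1]
    have hkey : x ^ 2 + 6 * x ^ 4 + 2 * x ^ 6 < 2 * x ^ 2 + 2 * x ^ 4 + 4 * x ^ 6 := by
      have h4 : x ^ 4 = x ^ 2 * x ^ 2 := by ring
      have h6 : x ^ 6 = x ^ 2 * x ^ 2 * x ^ 2 := by ring
      nlinarith [pow_pos hx.1 2, mul_pos (pow_pos hx.1 2) (pow_pos hx.1 2)]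
    have hpos : 0 < x ^ 2 + 6 * x ^ 4 + 2 * x ^ 6 := by
      have h2 := pow_pos hx.1 2; have h4 := pow_pos hx.1 4; have h6 := pow_pos hx.1 6; linarith
    nlinarith [hkey, hpos]
  · simp only [List.map_cons, List.map_nil, List.sum_cons, List.sum_nil, add_zero]
    have h2 := pow_pos hx.1 2; have h4 := pow_pos hx.1 4; have h6 := pow_pos hx.1 6
    nlinarith [mul_pos h2 h2, mul_pos h2 h4, mul_pos h4 h6, mul_pos h6 h6, mul_pos h2 h6, mul_pos h4 h4]
  · exact List.sum_nonneg (fun t ht => by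
      rw [List.mem_map] at ht; obtain ⟨m, -, rfl⟩ := ht; exact pow_nonneg hx.1.le m)
  · exact List.sum_nonneg (fun t ht => by
      rw [List.mem_map] at ht; obtain ⟨m, -, rfl⟩ := ht; exact pow_nonneg hx.1.le m)

/-- **The same admissible quadruple violates TP₂ at fugacity `3/5`.** [folklore] -/
theorem midpointTP2_fails_at_three_fifths :
    ¬ (Z₃ (3 / 5) ![0, 1] ![2, 1] * Z₃ (3 / 5) ![1, 0] ![1, 2] ≤ Z₃ (3 / 5) ![0, 1] ![1, 0] * Z₃ (3 / 5) ![2, 1] ![1, 2]) := by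
  intro h
  have h35 : (0 : ℝ) ≤ 3 / 5 := by norm_num
  rw [Z₃_01_21 h35, Z₃_10_12 h35, Z₃_01_10 h35, Z₃_21_12 h35, ← ENNReal.ofReal_mul, ← ENNReal.ofReal_mul,
    ENNReal.ofReal_le_ofReal_iff] at h
  · revert h
    norm_num
  · simp only [List.map_cons, List.map_nil, List.sum_cons, List.sum_nil, add_zero]
    positivity
  · simp only [List.map_cons, List.map_nil, List.sum_cons, List.sum_nil, add_zero]
    positivity
  · simp only [List.map_cons, List.map_nil, List.sum_cons, List.sum_nil, add_zero]
    positivity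

/-- **No fugacity-uniform TP₂**: the midpoint inequality, an honest instance of the hypotheses of
`BoundaryTP2` (`midpoints_interlaced`, `midpoints_D1`, `midpoints_D2`), fails for some fugacity in `(x_c, 1)`;
hence no weight-preserving injection (switching bijection) proves the crux. [folklore] -/
theorem not_midpointTP2_all_fugacities : ¬ ∀ x : ℝ, 0 ≤ x → x ≤ 1 →
    Z₃ x ![0, 1] ![2, 1] * Z₃ x ![1, 0] ![1, 2] ≤ Z₃ x ![0, 1] ![1, 0] * Z₃ x ![2, 1] ![1, 2] :=
  fun h => midpointTP2_fails_at_three_fifths (h _ (by norm_num) (by norm_num))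

end Midpoints

end Summit.CriticalPhenomena.SAWScalingLimit.Theorems.BoundaryTP2.Negative
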